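import Literature.Probability.Percolation.OrientedWalkMeeting
import Mathlib.Analysis.SpecialFunctions.Stirling
import Mathlib.Analysis.Complex.ExponentialBounds
import Mathlib.Analysis.Real.Pi.Bounds
import HarnessLib

/-!
# The Stirling tail `Σ_j (jd)!/((j!)^d d^{jd})` (BDNS Lemma 4.1: `E#Z < ∞` for `d ≥ 4`)

Topic `Literature/Probability/Percolation`.  Sorry-free, no named facts.  Bock–Damron–Newman–
Sidoravicius, *Percolation of finite clusters and shielded paths*, J. Stat. Phys. 179 (2020), end
of the proof of Lemma 4.1 (p. 10): "using Stirling's approximation with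
`1 ≤ n!/(n^n e^{-n} √(2πn)) ≤ e^{1/(12n)}` … `(1/d)^{jd} (jd)!/(j!)^d ≤ √(2πd) e^{1/(12d)}/(2π)^{d/2} j^{(1-d)/2}`
… This is finite for `d ≥ 4`."  We prove the variant obtained from Mathlib's global Stirling
bounds (`Stirling.le_factorial_stirling`: `√(2πn)(n/e)^n ≤ n!`, and `stirlingSeq n ≤ stirlingSeq 1`,
i.e. `n! ≤ e √n (n/e)^n`):

* `balancedTerm_sq_le`: `((jd)!/((j!)^d d^{jd}))² ≤ e² d/(2π)^d · j^{1-d}`;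
* `balancedTerm_le_div_pow_four`: for `d ≥ 9`, `(jd)!/((j!)^d d^{jd}) ≤ √(e²d/(2π)^d) / j⁴`;
* **`sum_balancedTerm_le`**: for `d ≥ 9` and every `n`,
  `Σ_{j=1}^{n} (jd)!/((j!)^d d^{jd}) ≤ tailBound d := d!/d^d + √(e² d/(2π)^d)/4`
  (the `j = 1` term exactly, `Σ_{j ≥ 2} j^{-4} ≤ 1/4`), the uniform bound `T` required by
  `criticalProb_zd_le_rho` and `retProb_zero_le`;
* `sqrt_stirlingConst_le`: a rational test for bounding `√(e² d/(2π)^d)` (`e < 2.7182818286`,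
  `π > 3.141592`).

## References

* B. Bock, M. Damron, C. M. Newman, V. Sidoravicius, J. Stat. Phys. 179 (2020) 789–807,
  arXiv:1811.01678, §4 (end of the proof of Lemma 4.1). [BockEtAl2020]
* W. Feller, *An introduction to probability theory and its applications* I, 3rd ed., Wiley 1968
  (Stirling bounds), as cited there; Mathlib `Mathlib.Analysis.SpecialFunctions.Stirling`.
-/

noncomputable section

namespace Literature.Probability.Percolation

open Finset Real
open scoped Nat

variable {d : ℕ}

/-! ### Two-sided Stirling bounds, squared -/

/-- Upper Stirling bound for all `n ≥ 1`: `n! ≤ e √n (n/e)^n` (the Stirling sequence is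
decreasing and `stirlingSeq 1 = e/√2`). [folklore] -/
theorem factorial_le_stirling {n : ℕ} (hn : n ≠ 0) :
    (n ! : ℝ) ≤ exp 1 * √n * (n / exp 1) ^ n := by
  cases n with
  | zero => exact absurd rfl hn
  | succ m =>
    have h1 : Stirling.stirlingSeq (m + 1) ≤ Stirling.stirlingSeq 1 :=
      Stirling.stirlingSeq'_antitone (Nat.zero_le m)
    rw [Stirling.stirlingSeq_one, Stirling.stirlingSeq,
      div_le_div_iff₀ (by positivity) (by positivity)] at h1
    have hsqrt : √(2 * ((m + 1 : ℕ) : ℝ)) = √2 * √((m + 1 : ℕ) : ℝ) := Real.sqrt_mul zero_le_two _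
    rw [hsqrt] at h1
    have h2 : 0 < √(2 : ℝ) := Real.sqrt_pos.2 zero_lt_two
    have h3 : ((m + 1)! : ℝ) * √2 ≤
        (exp 1 * √((m + 1 : ℕ) : ℝ) * (((m + 1 : ℕ) : ℝ) / exp 1) ^ (m + 1)) * √2 := by
      calc ((m + 1)! : ℝ) * √2 ≤ exp 1 * (√2 * √((m + 1 : ℕ) : ℝ) * (((m + 1 : ℕ) : ℝ) / exp 1) ^ (m + 1)) := h1
        _ = _ := by ring
    exact le_of_mul_le_mul_right h3 h2

/-- Squared upper bound: `(n!)² ≤ e² n (n/e)^{2n}`. [folklore] -/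
theorem factorial_sq_le {n : ℕ} (hn : n ≠ 0) :
    ((n ! : ℝ)) ^ 2 ≤ exp 1 ^ 2 * n * ((n / exp 1) ^ n) ^ 2 := by
  have h := factorial_le_stirling hn
  have h0 : (0 : ℝ) ≤ n ! := Nat.cast_nonneg _
  calc ((n ! : ℝ)) ^ 2 ≤ (exp 1 * √n * (n / exp 1) ^ n) ^ 2 := pow_le_pow_left₀ h0 h 2
    _ = exp 1 ^ 2 * (√(n : ℝ)) ^ 2 * ((n / exp 1) ^ n) ^ 2 := by ring
    _ = exp 1 ^ 2 * n * ((n / exp 1) ^ n) ^ 2 := by rw [Real.sq_sqrt (Nat.cast_nonneg n)]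

/-- Squared lower bound: `2πm (m/e)^{2m} ≤ (m!)²`. [folklore] -/
theorem le_factorial_sq (m : ℕ) : 2 * π * m * ((m / exp 1) ^ m) ^ 2 ≤ ((m ! : ℝ)) ^ 2 := by
  have h := Stirling.le_factorial_stirling m
  have h0 : 0 ≤ √(2 * π * m) * (m / exp 1) ^ m := by positivity
  calc 2 * π * m * ((m / exp 1) ^ m) ^ 2 = (√(2 * π * m) * (m / exp 1) ^ m) ^ 2 := by
        rw [mul_pow, Real.sq_sqrt (by positivity)]
    _ ≤ ((m ! : ℝ)) ^ 2 := pow_le_pow_left₀ h0 h 2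

/-! ### The balanced multinomial term -/

/-- The Stirling constant `e² d / (2π)^d` of the tail bound. [cite: BockEtAl2020, §4 (proof of Lemma 4.1)] -/
def stirlingConst (d : ℕ) : ℝ := exp 1 ^ 2 * d / (2 * π) ^ d

/-- `stirlingConst ≥ 0`. [folklore] -/
theorem stirlingConst_nonneg (d : ℕ) : 0 ≤ stirlingConst d := by
  unfold stirlingConst; positivity

/-- **`((jd)!/((j!)^d d^{jd}))² ≤ e² d (2π)^{-d} j^{1-d}`** (BDNS:
`(1/d)^{jd}(jd)!/(j!)^d ≤ √(2πd) e^{1/(12d)} (2π)^{-d/2} j^{(1-d)/2}`). [cite: BockEtAl2020, §4 (proof of Lemma 4.1)] -/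
theorem balancedTerm_sq_le (hd : 1 ≤ d) {j : ℕ} (hj : 1 ≤ j) :
    balancedTerm d j ^ 2 ≤ stirlingConst d / (j : ℝ) ^ (d - 1) := by
  have hjd : j * d ≠ 0 := Nat.mul_ne_zero (by omega) (by omega)
  have hj0 : (0 : ℝ) < j := by exact_mod_cast hj
  have hd0 : (0 : ℝ) < d := by exact_mod_cast hd
  have he : 0 < exp 1 := exp_pos 1
  have hup := factorial_sq_le hjd
  have hlow := le_factorial_sq j
  have hlowpos : 0 < 2 * π * j * ((j / exp 1) ^ j) ^ 2 := by positivity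
  -- the denominator is at least `(2πj (j/e)^{2j})^d d^{2jd}`
  have hden : (2 * π * j * ((j / exp 1) ^ j) ^ 2) ^ d * ((d : ℝ) ^ (j * d)) ^ 2 ≤
      (((j ! : ℝ)) ^ d * (d : ℝ) ^ (j * d)) ^ 2 := by
    calc (2 * π * j * ((j / exp 1) ^ j) ^ 2) ^ d * ((d : ℝ) ^ (j * d)) ^ 2
        ≤ (((j ! : ℝ)) ^ 2) ^ d * ((d : ℝ) ^ (j * d)) ^ 2 :=
          mul_le_mul_of_nonneg_right (pow_le_pow_left₀ hlowpos.le hlow d) (by positivity)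
      _ = _ := by ring
  -- the algebraic identity behind the cancellation `(jd/e)^{2jd} = (j/e)^{2jd} d^{2jd}`
  have key : (exp 1 ^ 2 * ((j * d : ℕ) : ℝ) * ((((j * d : ℕ) : ℝ) / exp 1) ^ (j * d)) ^ 2) /
      ((2 * π * j * ((j / exp 1) ^ j) ^ 2) ^ d * ((d : ℝ) ^ (j * d)) ^ 2) =
      exp 1 ^ 2 * d * j / ((2 * π) ^ d * (j : ℝ) ^ d) := by
    push_cast
    field_simp
    ring
  have hmain : balancedTerm d j ^ 2 ≤ exp 1 ^ 2 * d * j / ((2 * π) ^ d * (j : ℝ) ^ d) := by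
    rw [← key, balancedTerm, div_pow]
    calc (((j * d)! : ℝ)) ^ 2 / (((j ! : ℝ)) ^ d * (d : ℝ) ^ (j * d)) ^ 2
        ≤ (exp 1 ^ 2 * ((j * d : ℕ) : ℝ) * ((((j * d : ℕ) : ℝ) / exp 1) ^ (j * d)) ^ 2) /
            (((j ! : ℝ)) ^ d * (d : ℝ) ^ (j * d)) ^ 2 :=
          div_le_div_of_nonneg_right hup (by positivity)
      _ ≤ _ := div_le_div_of_nonneg_left (by positivity) (by positivity) hden
  refine hmain.trans (le_of_eq ?_)
  unfold stirlingConst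
  obtain ⟨d', rfl⟩ : ∃ d', d = d' + 1 := ⟨d - 1, by omega⟩
  rw [Nat.add_sub_cancel, pow_succ]
  field_simp
  ring

/-- For `d ≥ 9`: `(jd)!/((j!)^d d^{jd}) ≤ √(e²d/(2π)^d) / j⁴`. [cite: BockEtAl2020, §4 (proof of Lemma 4.1)] -/
theorem balancedTerm_le_div_pow_four (hd : 9 ≤ d) {j : ℕ} (hj : 1 ≤ j) :
    balancedTerm d j ≤ √(stirlingConst d) / (j : ℝ) ^ 4 := by
  have hj1 : (1 : ℝ) ≤ j := by exact_mod_cast hj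
  have hj0 : (0 : ℝ) < j := by linarith
  have h1 := balancedTerm_sq_le (by omega : 1 ≤ d) hj
  have h2 : stirlingConst d / (j : ℝ) ^ (d - 1) ≤ stirlingConst d / ((j : ℝ) ^ 4) ^ 2 := by
    rw [← pow_mul]
    exact div_le_div_of_nonneg_left (stirlingConst_nonneg d) (by positivity)
      (pow_le_pow_right₀ hj1 (by omega))
  have h3 : balancedTerm d j ^ 2 ≤ (√(stirlingConst d) / (j : ℝ) ^ 4) ^ 2 := by
    rw [div_pow, Real.sq_sqrt (stirlingConst_nonneg d)]
    exact h1.trans h2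
  exact (pow_le_pow_iff_left₀ (balancedTerm_nonneg d j) (by positivity) two_ne_zero).1 h3

/-- `Σ_{j=2}^{n} j^{-4} ≤ 1/4 - 1/(4n)` (`j^{-4} ≤ (4 j (j-1))^{-1}`, telescoping). [folklore] -/
theorem sum_inv_pow_four_le {n : ℕ} (hn : 1 ≤ n) :
    ∑ j ∈ Icc 2 n, 1 / (j : ℝ) ^ 4 ≤ 1 / 4 - 1 / (4 * (n : ℝ)) := by
  induction n with
  | zero => exact absurd hn (by norm_num)
  | succ m ih =>
    rcases Nat.eq_zero_or_pos m with rfl | hm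
    · norm_num
    · rw [Finset.sum_Icc_succ_top (by omega)]
      have ih' := ih hm
      have hx : (1 : ℝ) ≤ m := by exact_mod_cast hm
      have key : 1 / ((m + 1 : ℕ) : ℝ) ^ 4 ≤ 1 / (4 * (m : ℝ)) - 1 / (4 * ((m + 1 : ℕ) : ℝ)) := by
        push_cast
        have e1 : 1 / (4 * (m : ℝ)) - 1 / (4 * ((m : ℝ) + 1)) = 1 / (4 * (m : ℝ) * ((m : ℝ) + 1)) := by
          field_simp
          ring
        rw [e1, div_le_div_iff₀ (by positivity) (by positivity), one_mul, one_mul]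
        nlinarith [sq_nonneg ((m : ℝ) - 1), hx]
      linarith

/-- The uniform tail bound `T(d) = d!/d^d + √(e² d/(2π)^d)/4`. [cite: BockEtAl2020, §4 (proof of Lemma 4.1)] -/
def tailBound (d : ℕ) : ℝ := (d ! : ℝ) / (d : ℝ) ^ d + √(stirlingConst d) / 4

/-- `tailBound ≥ 0`. [folklore] -/
theorem tailBound_nonneg (d : ℕ) : 0 ≤ tailBound d := by unfold tailBound; positivity

/-- The first term: `balancedTerm d 1 = d!/d^d`. [folklore] -/
theorem balancedTerm_one (d : ℕ) : balancedTerm d 1 = (d ! : ℝ) / (d : ℝ) ^ d := by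
  simp [balancedTerm]

/-- **The Stirling tail, uniformly in `n`**: for `d ≥ 9`,
`Σ_{j=1}^{n} (jd)!/((j!)^d d^{jd}) ≤ d!/d^d + √(e² d/(2π)^d)/4`. [cite: BockEtAl2020, §4 (proof of Lemma 4.1)] -/
theorem sum_balancedTerm_le (hd : 9 ≤ d) (n : ℕ) :
    ∑ j ∈ Icc 1 n, balancedTerm d j ≤ tailBound d := by
  rcases Nat.eq_zero_or_pos n with rfl | hn
  · simp [tailBound_nonneg]
  have hsplit : Icc 1 n = insert 1 (Icc 2 n) := by
    ext j
    simp only [Finset.mem_Icc, Finset.mem_insert]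
    omega
  rw [hsplit, Finset.sum_insert (by simp), balancedTerm_one, tailBound]
  gcongr
  calc ∑ j ∈ Icc 2 n, balancedTerm d j ≤ ∑ j ∈ Icc 2 n, √(stirlingConst d) / (j : ℝ) ^ 4 :=
        Finset.sum_le_sum fun j hj => balancedTerm_le_div_pow_four hd (by
          have := (Finset.mem_Icc.1 hj).1; omega)
    _ = √(stirlingConst d) * ∑ j ∈ Icc 2 n, 1 / (j : ℝ) ^ 4 := by
        rw [Finset.mul_sum]
        exact Finset.sum_congr rfl fun j _ => by rw [mul_one_div]
    _ ≤ √(stirlingConst d) * (1 / 4) := by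
        refine mul_le_mul_of_nonneg_left ?_ (Real.sqrt_nonneg _)
        have h := sum_inv_pow_four_le hn
        have : 0 ≤ 1 / (4 * (n : ℝ)) := by positivity
        linarith
    _ = √(stirlingConst d) / 4 := by ring

/-- **A rational test for the Stirling constant**: if `7.3891 · d / 6.283184^d ≤ s²` (`s ≥ 0`) then
`√(e² d/(2π)^d) ≤ s` (`e < 2.7182818286`, `π > 3.141592`). [folklore] -/
theorem sqrt_stirlingConst_le {s : ℝ} (hs : 0 ≤ s)
    (h : (7.3891 : ℝ) * d / (6.283184 : ℝ) ^ d ≤ s ^ 2) : √(stirlingConst d) ≤ s := by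
  rw [Real.sqrt_le_left hs]
  refine le_trans ?_ h
  unfold stirlingConst
  have he : exp 1 ^ 2 ≤ (7.3891 : ℝ) := by
    have := Real.exp_one_lt_d9
    nlinarith [exp_pos 1]
  have hpi : (6.283184 : ℝ) ^ d ≤ (2 * π) ^ d := by
    refine pow_le_pow_left₀ (by norm_num) ?_ d
    have := Real.pi_gt_d6
    linarith
  calc exp 1 ^ 2 * d / (2 * π) ^ d ≤ (7.3891 : ℝ) * d / (2 * π) ^ d := by
        gcongr
    _ ≤ (7.3891 : ℝ) * d / (6.283184 : ℝ) ^ d :=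
        div_le_div_of_nonneg_left (by positivity) (by positivity) hpi

/-- Hence a rational test for the whole tail bound. [folklore] -/
theorem tailBound_le {s : ℝ} (hs : 0 ≤ s)
    (h : (7.3891 : ℝ) * d / (6.283184 : ℝ) ^ d ≤ s ^ 2) :
    tailBound d ≤ (d ! : ℝ) / (d : ℝ) ^ d + s / 4 := by
  unfold tailBound
  have := sqrt_stirlingConst_le hs h
  linarith


/-! ### A sharper tail: the first two terms exactly, Stirling from `j = 3` on -/

/-- `Σ_{j=3}^{n} j^{-4} ≤ 1/24 - 1/(3n³)` (`j^{-4} ≤ (1/3)((j-1)^{-3} - j^{-3})`, telescoping). [folklore] -/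
theorem sum_inv_pow_four_le_three {n : ℕ} (hn : 2 ≤ n) :
    ∑ j ∈ Icc 3 n, 1 / (j : ℝ) ^ 4 ≤ 1 / 24 - 1 / (3 * (n : ℝ) ^ 3) := by
  induction n with
  | zero => exact absurd hn (by norm_num)
  | succ m ih =>
    rcases Nat.lt_or_ge m 2 with hm | hm
    · interval_cases m
      · omega
      · norm_num
    · rw [Finset.sum_Icc_succ_top (by omega)]
      have ih' := ih hm
      have hx : (2 : ℝ) ≤ m := by exact_mod_cast hm
      have key : 1 / ((m + 1 : ℕ) : ℝ) ^ 4 ≤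
          1 / (3 * (m : ℝ) ^ 3) - 1 / (3 * ((m + 1 : ℕ) : ℝ) ^ 3) := by
        push_cast
        rw [div_sub_div _ _ (by positivity) (by positivity),
          div_le_div_iff₀ (by positivity) (by positivity)]
        nlinarith [sq_nonneg ((m : ℝ) - 1), hx, pow_pos (show (0 : ℝ) < m by linarith) 3,
          pow_pos (show (0 : ℝ) < m + 1 by linarith) 3, mul_pos (show (0 : ℝ) < m by linarith)
          (show (0 : ℝ) < m + 1 by linarith)]
      linarith

/-- The sharper uniform tail bound `T₂(d) = d!/d^d + (2d)!/(2^d d^{2d}) + √(e² d/(2π)^d)/24`.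
[cite: BockEtAl2020, §4 (proof of Lemma 4.1)] -/
def tailBound₂ (d : ℕ) : ℝ :=
  (d ! : ℝ) / (d : ℝ) ^ d + ((2 * d)! : ℝ) / ((2 : ℝ) ^ d * (d : ℝ) ^ (2 * d)) + √(stirlingConst d) / 24

/-- `tailBound₂ ≥ 0`. [folklore] -/
theorem tailBound₂_nonneg (d : ℕ) : 0 ≤ tailBound₂ d := by unfold tailBound₂; positivity

/-- The second term: `balancedTerm d 2 = (2d)!/(2^d d^{2d})`. [folklore] -/
theorem balancedTerm_two (d : ℕ) :
    balancedTerm d 2 = ((2 * d)! : ℝ) / ((2 : ℝ) ^ d * (d : ℝ) ^ (2 * d)) := by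
  simp [balancedTerm, Nat.factorial]

/-- **The Stirling tail, sharper form**: for `d ≥ 9` and every `n`,
`Σ_{j=1}^{n} (jd)!/((j!)^d d^{jd}) ≤ d!/d^d + (2d)!/(2^d d^{2d}) + √(e² d/(2π)^d)/24`.
[cite: BockEtAl2020, §4 (proof of Lemma 4.1)] -/
theorem sum_balancedTerm_le₂ (hd : 9 ≤ d) (n : ℕ) :
    ∑ j ∈ Icc 1 n, balancedTerm d j ≤ tailBound₂ d := by
  rcases Nat.lt_or_ge n 2 with hn | hn
  · interval_cases n
    · simp [tailBound₂_nonneg]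
    · rw [show Icc 1 1 = {1} by rfl, Finset.sum_singleton, balancedTerm_one, tailBound₂]
      have h1 : 0 ≤ ((2 * d)! : ℝ) / ((2 : ℝ) ^ d * (d : ℝ) ^ (2 * d)) := by positivity
      have h2 : 0 ≤ √(stirlingConst d) / 24 := by positivity
      linarith
  have hsplit : Icc 1 n = insert 1 (insert 2 (Icc 3 n)) := by
    ext j
    simp only [Finset.mem_Icc, Finset.mem_insert]
    omega
  rw [hsplit, Finset.sum_insert (by simp), Finset.sum_insert (by simp), balancedTerm_one,
    balancedTerm_two, tailBound₂, ← add_assoc]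
  gcongr
  calc ∑ j ∈ Icc 3 n, balancedTerm d j ≤ ∑ j ∈ Icc 3 n, √(stirlingConst d) / (j : ℝ) ^ 4 :=
        Finset.sum_le_sum fun j hj => balancedTerm_le_div_pow_four hd (by
          have := (Finset.mem_Icc.1 hj).1; omega)
    _ = √(stirlingConst d) * ∑ j ∈ Icc 3 n, 1 / (j : ℝ) ^ 4 := by
        rw [Finset.mul_sum]
        exact Finset.sum_congr rfl fun j _ => by rw [mul_one_div]
    _ ≤ √(stirlingConst d) * (1 / 24) := by
        refine mul_le_mul_of_nonneg_left ?_ (Real.sqrt_nonneg _)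
        have h := sum_inv_pow_four_le_three hn
        have : 0 ≤ 1 / (3 * (n : ℝ) ^ 3) := by positivity
        linarith
    _ = √(stirlingConst d) / 24 := by ring

/-- A rational test for the sharper tail bound. [folklore] -/
theorem tailBound₂_le {s : ℝ} (hs : 0 ≤ s)
    (h : (7.3891 : ℝ) * d / (6.283184 : ℝ) ^ d ≤ s ^ 2) :
    tailBound₂ d ≤ (d ! : ℝ) / (d : ℝ) ^ d + ((2 * d)! : ℝ) / ((2 : ℝ) ^ d * (d : ℝ) ^ (2 * d)) + s / 24 := by
  unfold tailBound₂
  have := sqrt_stirlingConst_le hs h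
  linarith

end Literature.Probability.Percolation

end
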